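import Mathlib
import Literature.NumberTheory.LFunctions.Zhang2022.Section17R1PrimeBulkSplit
import Literature.NumberTheory.LFunctions.Zhang2022.Section17R1PrimeBulkMain
import Literature.NumberTheory.LFunctions.Zhang2022.Section17R1PrimeBulkTailSum
import Literature.NumberTheory.LFunctions.Zhang2022.Section3Lemma32FlatLong
import HarnessLib

/-!
# Zhang (2022) §17.u021, remainder `R₁`, piece M2L-p BULK: the explicit bound under (A)
# (all number theory done; only the numerical `→ 0` remains)

Topic `Literature/NumberTheory/LFunctions/Zhang2022` (Landau–Siegel audit tree; verdict-neutral).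
Y. Zhang, *Discrete mean estimates and the Landau–Siegel zero*, arXiv:2211.02515v1 (2022)
[Zhang2022LandauSiegel] — **an unrefereed manuscript under adjudication**; nothing here asserts or denies
its Theorems 1–2. §17 p. 98 (u021; no bound in print). Piece M2L-p BULK of the sub-leaf `R₁` of
`Typed.Section17.Step17_u021Chi` (WP16 leaf h17_9; owner zl-libB-p6, cut 2026-08-27T02:29:31Z;
blueprint `wp16/zl-w16-p3/R1-BULK-PLAN.md`). THIS FILE combines the split (`bulk_le_main_add_tail`),
the two outer counts (`bulk_main_pert_sum_le`, `bulk_tail_sum_le`) and — the only use of (A) — the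
tree's Lemma 3.2♭ on the long range (`Lemma32Flat.lemma_3_2_flat_long`) into an EXPLICIT bound: for all
large `D` under (A),

  `BULK(D) ≤ 16Cα𝓛^{11/10}·( H_D·(2M₄,₆(log D⁴)⁴ + 8δM₁₂,₈(log D⁴)¹²) + K₄(D)²·log₂⌊T²/4⌋·C₃₂/(log D)^{2007} )`

with `H_D = Σ_{p∈P₀} 1/p` (`P₀` = primes `p ≤ ⌊T²⌋`, `4D⁴p ≤ T²`), `K₄(D) = Σ_{n<D⁴} τ₂(n)²/n`,
`δ = 10α𝓛^{11/10} + ½e^{−𝓛³⁰}`. Since `α𝓛^{11/10} = π𝓛^{−7.9}`, `H_D ≪ 𝓛^{1.1}`, `K₄ ≪ 𝓛⁴`,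
`δ ≪ 𝓛^{−7.9}`, the right side is `O(𝓛^{−2.7})`; the numerical `≤ ε` step (the statement
`R1_prime_bulk_small` of the owner's A5) is the next file. Theorems only; axioms standard.

## References

* Y. Zhang, arXiv:2211.02515v1 (2022), §17 p. 98 (u021), §3 Lemma 3.2. [cite: Zhang2022LandauSiegel, §17 u021 p.98]
-/

noncomputable section

open Complex Real Finset ArithmeticFunction
open Literature.NumberTheory.LFunctions.Zhang2022.Skeleton
open Literature.NumberTheory.LFunctions.Zhang2022.Typed.Section17
open Literature.NumberTheory.LFunctions.Zhang2022.MeanSquareMajorant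

namespace Literature.NumberTheory.LFunctions.Zhang2022.Phi3Eval

/-- **M2L-p BULK, explicit bound under (A)** (blueprint Steps A–D assembled; the numerical `→ 0` is
left to the closer). [cite: Zhang2022LandauSiegel, §17 u021 p.98] -/
theorem R1_prime_bulk_bound (c' : ℝ)
    (hM1 : ∃ C : ℝ, ForAllLarge fun D _ _ => ∀ q₁ m₂ : ℕ, 1 ≤ q₁ → 1 ≤ m₂ →
      (∑' m₁ : ℕ, ‖bcoef D (q₁ * m₁)‖ * ‖kappa2bar c' D (m₁ * m₂)‖ / (m₁ : ℝ)) ≤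
        C * (q₁.divisors.card : ℝ) * ‖kappa2bar c' D m₂‖ * ((m₂ : ℝ) / m₂.totient) ^ 2) :
    ∃ C : ℝ, 0 ≤ C ∧ ∃ C₃₂ : ℝ, ForAllLarge fun D _ χ => AssumptionA D χ →
      ∑ l ∈ Finset.Ico 1 (D ^ 4), ‖nu χ l‖ / l *
        ∑ q ∈ l.divisorsAntidiagonal, ∑' m₁ : ℕ, ∑' p : ℕ,
          (if (D : ℝ) ^ 4 < q.2 * p ∧ p.Prime ∧ ¬ p ∣ q.1 ∧ 4 * (D : ℝ) ^ 4 * p ≤ bigT D ^ 2 then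
            ‖bcoef D (q.1 * m₁)‖ * ‖nuOneStar c' χ (q.2 * p)‖ * ‖kappa2bar c' D (m₁ * p)‖ /
              ((m₁ : ℝ) * p) else 0) ≤
      16 * C * alpha D * ell D ^ (11 / 10 : ℝ) *
        ((∑ p ∈ (Finset.range (⌊bigT D ^ 2⌋₊ + 1)).filter
            (fun p : ℕ => p.Prime ∧ 4 * (D : ℝ) ^ 4 * p ≤ bigT D ^ 2), (1 : ℝ) / p) *
          (2 * (majorantConst 4 6 * Real.log ((D ^ 4 : ℕ) : ℝ) ^ 4) +
            8 * (10 * alpha D * ell D ^ (11 / 10 : ℝ) + (1 / 2 : ℝ) * Real.exp (-(ell D ^ 30))) *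
              (majorantConst 12 8 * Real.log ((D ^ 4 : ℕ) : ℝ) ^ 12)) +
          (∑ n ∈ Finset.Ico 1 (D ^ 4), tau 2 n ^ 2 / n) ^ 2 *
            ((Nat.log 2 ⌊bigT D ^ 2 / 4⌋₊ : ℝ) * (C₃₂ / Real.log D ^ 2007))) := by
  classical
  obtain ⟨C, hM1⟩ := hM1
  obtain ⟨C₃₂, h32⟩ := Lemma32Flat.lemma_3_2_flat_long
  refine ⟨max C 0, le_max_right _ _, C₃₂, ?_⟩
  obtain ⟨D₁, hD₁⟩ := hE_thresholds c' 0 1 one_pos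
  obtain ⟨D₂, hM1'⟩ := hM1
  refine ⟨max D₁ (max D₂ 2), fun D _ χ hD hq hp hA => ?_⟩
  have hD1 : D₁ ≤ D := le_trans (le_max_left _ _) hD
  have hD2 : D₂ ≤ D := le_trans (le_trans (le_max_left _ _) (le_max_right _ _)) hD
  have hD2' : 2 ≤ D := le_trans (le_trans (le_max_right _ _) (le_max_right _ _)) hD
  obtain ⟨hℓ3, hc, -, -, -⟩ := hD₁ D hD1
  have hℓ0 : 0 < ell D := by linarith
  have hℓ1 : 1 ≤ ell D := by linarith
  have hα0 : 0 < alpha D := alpha_pos' hℓ0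
  -- M1 at this `D`, with the nonnegative constant `max C 0`
  have hM1D : ∀ q₁ m₂ : ℕ, 1 ≤ q₁ → 1 ≤ m₂ →
      (∑' m₁ : ℕ, ‖bcoef D (q₁ * m₁)‖ * ‖kappa2bar c' D (m₁ * m₂)‖ / (m₁ : ℝ)) ≤
        max C 0 * (q₁.divisors.card : ℝ) * ‖kappa2bar c' D m₂‖ * ((m₂ : ℝ) / m₂.totient) ^ 2 := by
    intro q₁ m₂ h1 h2
    refine (hM1' D χ hD2 hq hp q₁ m₂ h1 h2).trans ?_
    have h0 : 0 ≤ (q₁.divisors.card : ℝ) * ‖kappa2bar c' D m₂‖ * ((m₂ : ℝ) / m₂.totient) ^ 2 := by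
      positivity
    nlinarith [le_max_left C 0]
  -- Step C
  have hsplit := bulk_le_main_add_tail c' χ hq hℓ3 hc (le_max_right C 0) hM1D
  refine hsplit.trans (mul_le_mul_of_nonneg_left (add_le_add ?_ ?_) (by positivity))
  · -- Steps D1–D2: pass from `Ico` to `Icc` and apply the Hall–Tenenbaum pair
    have hX2 : 2 ≤ D ^ 4 := le_trans hD2' (Nat.le_self_pow (by norm_num) D)
    have hδ0 : 0 ≤ 10 * alpha D * ell D ^ (11 / 10 : ℝ) + (1 / 2 : ℝ) * Real.exp (-(ell D ^ 30)) := by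
      positivity
    refine le_trans (Finset.sum_le_sum_of_subset_of_nonneg Finset.Ico_subset_Icc_self
      fun l _ _ => ?_) (bulk_main_pert_sum_le χ hq hX2 hδ0 _)
    refine mul_nonneg (by positivity) (Finset.sum_nonneg fun q _ => mul_nonneg (tau_nonneg _ _)
      (Finset.sum_nonneg fun p _ => div_nonneg (add_nonneg (by positivity)
        (mul_nonneg (by positivity) (mul_nonneg (by norm_num) (tau_nonneg _ _)))) (Nat.cast_nonneg p)))
  · -- Step D3 + Lemma 3.2♭ (long range) — the only use of (A)
    set P₀ := (Finset.range (⌊bigT D ^ 2⌋₊ + 1)).filter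
      (fun p : ℕ => p.Prime ∧ 4 * (D : ℝ) ^ 4 * p ≤ bigT D ^ 2) with hP₀
    set X : ℕ := ⌊bigT D ^ 2 / 4⌋₊ with hXdef
    have hP : ∀ p ∈ P₀, p.Prime := fun p hp => (Finset.mem_filter.1 hp).2.1
    have hX : ∀ p ∈ P₀, ∀ a ∈ Finset.Ico 1 (D ^ 4), p * a ≤ X := by
      intro p hp a ha
      have h4 := (Finset.mem_filter.1 hp).2.2
      have ha' : (a : ℝ) ≤ (D : ℝ) ^ 4 := by
        have := (Finset.mem_Ico.1 ha).2.le; exact_mod_cast this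
      have hp0 : (0 : ℝ) ≤ p := Nat.cast_nonneg p
      rw [hXdef]
      refine Nat.le_floor ?_
      push_cast
      rw [le_div_iff₀ (by norm_num : (0:ℝ) < 4)]
      nlinarith
    have htail := bulk_tail_sum_le χ P₀ hP (D ^ 4) X hX
    refine htail.trans (mul_le_mul_of_nonneg_left (mul_le_mul_of_nonneg_left ?_ (Nat.cast_nonneg _))
      (sq_nonneg _))
    -- Lemma 3.2♭ on `(D⁴, X]`, `X ≤ T²/4 ≤ e^{2𝓛⁹}`
    have hlog : 3 ≤ Real.log D := hℓ3
    have hXexp : (X : ℝ) ≤ Real.exp (2 * Real.log D ^ 9) := by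
      have hT0 : 0 ≤ bigT D ^ 2 / 4 := by positivity
      have h1 : (X : ℝ) ≤ bigT D ^ 2 / 4 := Nat.floor_le hT0
      have h2 : bigT D ^ 2 / 4 ≤ bigT D ^ 2 := by nlinarith [sq_nonneg (bigT D)]
      have h3 : bigT D ^ 2 = Real.exp (2 * ell D ^ (11 / 10 : ℝ)) := by
        rw [bigT, ← Real.exp_nat_mul]; norm_num
      have h4 : 2 * ell D ^ (11 / 10 : ℝ) ≤ 2 * Real.log D ^ 9 := by
        rw [← ell]
        have : ell D ^ (11 / 10 : ℝ) ≤ ell D ^ ((9 : ℕ) : ℝ) :=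
          Real.rpow_le_rpow_of_exponent_le hℓ1 (by norm_num)
        rw [Real.rpow_natCast] at this
        linarith
      calc (X : ℝ) ≤ bigT D ^ 2 := h1.trans h2
        _ = Real.exp (2 * ell D ^ (11 / 10 : ℝ)) := h3
        _ ≤ Real.exp (2 * Real.log D ^ 9) := Real.exp_le_exp.2 h4
    have key := h32 D χ hp hq.sq_eq_one hlog hA.le X hXexp
    refine le_trans (le_of_eq ?_) key
    refine Finset.sum_congr rfl fun n _ => ?_
    rw [nu, tau_two_apply]

end Literature.NumberTheory.LFunctions.Zhang2022.Phi3Eval
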